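import Summits.Langlands.Langlands.Theorems.ExteriorSquareAscentReducibleInducesSquareStubNoPlanesAnalyticCores

/-!
# Stub `stub_noPlanesAnalytic` of line `Sketch` for crux stmt-Langlands-18054 — V: the `(2,2)` case off
the unitary axis, from the automorphic data

(`Summit.Langlands.Langlands.Theses.ExteriorSquareAscent.ReducibleInducesSquare`; serving the glue item
stmt-Langlands-18147 `ReducibleInducesSquareGivenJSAR`.)

`false_of_large_pairChar_twoTwo`: as `false_of_unitary_pairChar_twoTwo`, but with `|χ| = ‖·‖^{-t}` for
some `t > 0` (so `|χ(ϖ_w)| = q_w^{t} > 1`) and WITHOUT any hypothesis on essential self-duality: with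
`‖·‖^{-t}` (`exists_heckeCharacter_ideleNorm_cpow`) and the unitary characters `u = χ⁻¹‖·‖^{-t}`,
`u_λ = ω u²` (`λ = ω χ⁻² = q^{-2t} u_λ` at `ϖ`), the eleven twists of the `(2,2)` identity are
`q^{-2t}u_λ, q^{-4t}u_λ², q^{-6t}u_λ³, q^{-3t}u_λu (×3), q^{-3t}u⁻¹u_λ², q^{-2t}u_λ, q^{-4t}u_λ², q^{-t}u,
q^{-5t}u_λ²u` — all shifted INTO `Re s > 1` — and `false_of_twoTwo_eulerIdentity_of_shift` applies to the
analytic packages of the twelve slots.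
-/

set_option linter.dupNamespace false -- `Summit.Langlands.Langlands` is the mandated namespace

noncomputable section

namespace Summit.Langlands.Langlands.Cruxes.ReducibleInducesSquare.Sketch

open Literature.NumberTheory.GaloisRepresentations Literature.NumberTheory.Automorphic
open NumberField IsDedekindDomain Filter Polynomial
open scoped Classical MatrixGroups NumberField Topology

variable {F : Type} [Field F] [NumberField F] in
/-- `(χ₁ χ₂)(ϖ_v) = χ₁(ϖ_v) χ₂(ϖ_v)`. [folklore] -/
private theorem np_vAU_mul (χ₁ χ₂ : HeckeCharacter F) (v : HeightOneSpectrum (𝓞 F)) :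
    (χ₁ * χ₂).valueAtUniformizer v = χ₁.valueAtUniformizer v * χ₂.valueAtUniformizer v := by
  simp only [Literature.NumberTheory.GaloisRepresentations.HeckeCharacter.valueAtUniformizer,
    Literature.NumberTheory.GaloisRepresentations.HeckeCharacter.localComponent_apply,
    Literature.NumberTheory.GaloisRepresentations.HeckeCharacter.mul_apply, Units.val_mul]

variable {F : Type} [Field F] [NumberField F] in
/-- `χ⁻¹(ϖ_v) = χ(ϖ_v)⁻¹`. [folklore] -/
private theorem np_vAU_inv (χ : HeckeCharacter F) (v : HeightOneSpectrum (𝓞 F)) :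
    χ⁻¹.valueAtUniformizer v = (χ.valueAtUniformizer v)⁻¹ := by
  simp only [Literature.NumberTheory.GaloisRepresentations.HeckeCharacter.valueAtUniformizer,
    Literature.NumberTheory.GaloisRepresentations.HeckeCharacter.localComponent_apply,
    Literature.NumberTheory.GaloisRepresentations.HeckeCharacter.inv_apply, Units.val_inv_eq_inv_val]

variable {F : Type} [Field F] [NumberField F] in
/-- `χ(ϖ_v) ≠ 0`. [folklore] -/
private theorem np_vAU_ne_zero (χ : HeckeCharacter F) (v : HeightOneSpectrum (𝓞 F)) :
    χ.valueAtUniformizer v ≠ 0 := by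
  simp only [Literature.NumberTheory.GaloisRepresentations.HeckeCharacter.valueAtUniformizer,
    Literature.NumberTheory.GaloisRepresentations.HeckeCharacter.localComponent_apply]
  exact Units.ne_zero _

section DataOff

variable {F : Type} [Field F] [NumberField F]

/-- `(q_v : ℂ) ^ z ≠ 0`. [folklore] -/
theorem np_qpow_ne_zero (v : HeightOneSpectrum (𝓞 F)) (z : ℂ) : (v.residueCard : ℂ) ^ z ≠ 0 := by
  have hq : (v.residueCard : ℂ) ≠ 0 :=
    Nat.cast_ne_zero.2 (ne_of_gt (lt_trans zero_lt_one v.one_lt_residueCard))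
  exact fun h => hq ((Complex.cpow_eq_zero_iff _ _).1 h).1

/-- **The `(2,2)` case OFF the unitary axis** (module docstring).
[cite: Shavali2026, Prop. 4.2] [cite: JacquetShalikaAJM1981, Thm. (5.3)]
[cite: ArthurClozelAMS120, Ch. 3 §2 (2.1)–(2.3)] -/
theorem false_of_large_pairChar_twoTwo
    (hJ2 : JacquetShalika1981_partialPairL_boundary_repData)
    (hJ3 : JacquetShalika1981_partialPairL_pole_repData)
    {h4 : isCompact_glFiniteIntegralLevel 4 F} {h6 : isCompact_glFiniteIntegralLevel 6 F}
    (P Pd : CuspidalAutomorphicRepData 4 F h4) (P₆ : CuspidalAutomorphicRepData 6 F h6)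
    (α : SatakeFamily F)
    (hP : ∀ᶠ w : HeightOneSpectrum (𝓞 F) in cofinite, P.1.HasSatakeParamAt w (α w))
    (hPd : ∀ᶠ w : HeightOneSpectrum (𝓞 F) in cofinite, Pd.1.HasSatakeParamAt w ((α w).map (·⁻¹)))
    (hP₆ : ∀ᶠ w : HeightOneSpectrum (𝓞 F) in cofinite, P₆.1.HasSatakeParamAt w (wedgeTwoParams (α w)))
    (huα : ∀ᶠ w : HeightOneSpectrum (𝓞 F) in cofinite, ‖(α w).prod‖ = 1)
    (χ : HeckeCharacter F) {t : ℝ} (ht : 0 < t)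
    (hχt : ∀ x : ideleGroup F, ‖((χ x : ℂˣ) : ℂ)‖ =
      Literature.NumberTheory.GaloisRepresentations.ideleNorm x ^ (-t))
    (hsplit : ∀ᶠ w : HeightOneSpectrum (𝓞 F) in cofinite, ∃ β γ : Multiset ℂ,
      β + γ = α w ∧ Multiset.card β = 2 ∧ β.prod = χ.valueAtUniformizer w) :
    False := by
  have h1 : isCompact_glFiniteIntegralLevel 1 F := isCompact_glFiniteIntegralLevel_holds 1 F
  haveI : NeZero (4 : ℕ) := ⟨by norm_num⟩
  haveI : NeZero (6 : ℕ) := ⟨by norm_num⟩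
  obtain ⟨Ω, hΩ⟩ := centralCharacter_satake_of_cuspidal P
  set lam : HeckeCharacter F := Ω * χ⁻¹ * χ⁻¹ with hlamdef
  -- the norm character `‖·‖^{-t}` and the local constants `q_w^{-t}`
  obtain ⟨nt, hnt⟩ := exists_heckeCharacter_ideleNorm_cpow F (((-t : ℝ)) : ℂ)
  have hc : ∀ w : HeightOneSpectrum (𝓞 F),
      nt.valueAtUniformizer w = ((w.residueCard : ℂ) ^ (((-t : ℝ)) : ℂ))⁻¹ :=
    HeckeCharacter.valueAtUniformizer_of_cpow hnt
  have hc0 : ∀ w : HeightOneSpectrum (𝓞 F), (w.residueCard : ℂ) ^ (((-t : ℝ)) : ℂ) ≠ 0 :=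
    fun w => np_qpow_ne_zero w _
  have hnχ : ∀ w : HeightOneSpectrum (𝓞 F), ‖χ.valueAtUniformizer w‖ = (w.residueCard : ℝ) ^ t :=
    fun w => by rw [norm_valueAtUniformizer_eq_rpow_neg_of_norm_apply hχt, neg_neg]
  have hc2 : ∀ w : HeightOneSpectrum (𝓞 F),
      (w.residueCard : ℂ) ^ (((-(2 * t) : ℝ)) : ℂ) = ((w.residueCard : ℂ) ^ (((-t : ℝ)) : ℂ)) ^ 2 :=
    fun w => by rw [← Complex.cpow_nat_mul]; congr 1; push_cast; ring
  have hc3 : ∀ w : HeightOneSpectrum (𝓞 F),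
      (w.residueCard : ℂ) ^ (((-(3 * t) : ℝ)) : ℂ) = ((w.residueCard : ℂ) ^ (((-t : ℝ)) : ℂ)) ^ 3 :=
    fun w => by rw [← Complex.cpow_nat_mul]; congr 1; push_cast; ring
  have hc4 : ∀ w : HeightOneSpectrum (𝓞 F),
      (w.residueCard : ℂ) ^ (((-(4 * t) : ℝ)) : ℂ) = ((w.residueCard : ℂ) ^ (((-t : ℝ)) : ℂ)) ^ 4 :=
    fun w => by rw [← Complex.cpow_nat_mul]; congr 1; push_cast; ring
  have hc5 : ∀ w : HeightOneSpectrum (𝓞 F),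
      (w.residueCard : ℂ) ^ (((-(5 * t) : ℝ)) : ℂ) = ((w.residueCard : ℂ) ^ (((-t : ℝ)) : ℂ)) ^ 5 :=
    fun w => by rw [← Complex.cpow_nat_mul]; congr 1; push_cast; ring
  have hc6 : ∀ w : HeightOneSpectrum (𝓞 F),
      (w.residueCard : ℂ) ^ (((-(6 * t) : ℝ)) : ℂ) = ((w.residueCard : ℂ) ^ (((-t : ℝ)) : ℂ)) ^ 6 :=
    fun w => by rw [← Complex.cpow_nat_mul]; congr 1; push_cast; ring
  -- the unitary characters `u = χ⁻¹ ‖·‖^{-t}`, `u_λ = ω u²`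
  set u : HeckeCharacter F := χ⁻¹ * nt with hudef
  set ul : HeckeCharacter F := Ω * u * u with huldef
  have huw : ∀ w, u.valueAtUniformizer w =
      (χ.valueAtUniformizer w)⁻¹ * ((w.residueCard : ℂ) ^ (((-t : ℝ)) : ℂ))⁻¹ := fun w => by
    rw [hudef, np_vAU_mul, np_vAU_inv, hc]
  have hulw : ∀ w, ul.valueAtUniformizer w =
      Ω.valueAtUniformizer w * u.valueAtUniformizer w * u.valueAtUniformizer w := fun w => by
    rw [huldef, np_vAU_mul, np_vAU_mul]
  have hlamw : ∀ w, lam.valueAtUniformizer w =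
      Ω.valueAtUniformizer w * (χ.valueAtUniformizer w)⁻¹ * (χ.valueAtUniformizer w)⁻¹ := fun w => by
    rw [hlamdef, np_vAU_mul, np_vAU_mul, np_vAU_inv]
  have hnu : ∀ w, ‖u.valueAtUniformizer w‖ = 1 := fun w => by
    have hq : (0 : ℝ) < w.residueCard := by exact_mod_cast lt_trans zero_lt_one w.one_lt_residueCard
    rw [huw, norm_mul, norm_inv, norm_inv, hnχ, Complex.norm_natCast_cpow_of_pos
      (Nat.zero_lt_of_lt w.one_lt_residueCard), Complex.ofReal_re, Real.rpow_neg hq.le, inv_inv,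
      inv_mul_cancel₀ (Real.rpow_pos_of_pos hq t).ne']
  -- the good places
  have hgood : ∀ᶠ w : HeightOneSpectrum (𝓞 F) in cofinite, P.1.HasSatakeParamAt w (α w) ∧
      Ω.valueAtUniformizer w = (α w).prod ∧ ∃ β γ : Multiset ℂ,
        β + γ = α w ∧ Multiset.card β = 2 ∧ β.prod = χ.valueAtUniformizer w := by
    filter_upwards [hP, hΩ, hsplit] with w h₁ h₂ h₃
    exact ⟨h₁, h₂ _ h₁, h₃⟩
  have hnΩ : ∀ᶠ w : HeightOneSpectrum (𝓞 F) in cofinite, ‖Ω.valueAtUniformizer w‖ = 1 := by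
    filter_upwards [hgood, huα] with w hw hu'
    rw [hw.2.1, hu']
  have hnu' : ∀ᶠ w : HeightOneSpectrum (𝓞 F) in cofinite, ‖u.valueAtUniformizer w‖ = 1 :=
    Eventually.of_forall hnu
  have hnui : ∀ᶠ w : HeightOneSpectrum (𝓞 F) in cofinite, ‖u⁻¹.valueAtUniformizer w‖ = 1 :=
    Eventually.of_forall fun w => by rw [np_vAU_inv, norm_inv, hnu, inv_one]
  have hn2 : ∀ {θ₁ θ₂ : HeckeCharacter F}, (∀ᶠ w : HeightOneSpectrum (𝓞 F) in cofinite,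
      ‖θ₁.valueAtUniformizer w‖ = 1) → (∀ᶠ w : HeightOneSpectrum (𝓞 F) in cofinite,
      ‖θ₂.valueAtUniformizer w‖ = 1) →
      ∀ᶠ w : HeightOneSpectrum (𝓞 F) in cofinite, ‖(θ₁ * θ₂).valueAtUniformizer w‖ = 1 :=
    fun h₁ h₂ => by
    filter_upwards [h₁, h₂] with w hw₁ hw₂
    rw [np_vAU_mul, norm_mul, hw₁, hw₂, one_mul]
  have hnul : ∀ᶠ w : HeightOneSpectrum (𝓞 F) in cofinite, ‖ul.valueAtUniformizer w‖ = 1 :=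
    hn2 (hn2 hnΩ hnu') hnu'
  -- unitarity of the families
  have huαd : ∀ᶠ w : HeightOneSpectrum (𝓞 F) in cofinite, ‖((α w).map (·⁻¹)).prod‖ = 1 :=
    huα.mono fun w hw => by rw [Multiset.prod_map_inv, Multiset.map_id', norm_inv, hw, inv_one]
  have huB : ∀ᶠ w : HeightOneSpectrum (𝓞 F) in cofinite, ‖(wedgeTwoParams (α w)).prod‖ = 1 := by
    filter_upwards [hP, huα] with w hPw hu'
    rw [prod_wedgeTwoParams, hPw.card_eq, norm_pow, hu', one_pow]
  have hutw : ∀ {θ : HeckeCharacter F} {M : SatakeFamily F},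
      (∀ᶠ w : HeightOneSpectrum (𝓞 F) in cofinite, ‖θ.valueAtUniformizer w‖ = 1) →
      (∀ᶠ w : HeightOneSpectrum (𝓞 F) in cofinite, ‖(M w).prod‖ = 1) →
      ∀ᶠ w : HeightOneSpectrum (𝓞 F) in cofinite, ‖((M w).map (θ.valueAtUniformizer w * ·)).prod‖ = 1 :=
    fun h₁ h₂ => by
    filter_upwards [h₁, h₂] with w hw₁ hw₂
    rw [prod_map_const_mul_eq, norm_mul, norm_pow, hw₁, hw₂, one_pow, one_mul]
  have hu1 : ∀ {θ : HeckeCharacter F},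
      (∀ᶠ w : HeightOneSpectrum (𝓞 F) in cofinite, ‖θ.valueAtUniformizer w‖ = 1) →
      ∀ᶠ w : HeightOneSpectrum (𝓞 F) in cofinite, ‖(({θ.valueAtUniformizer w} : Multiset ℂ)).prod‖ = 1 :=
    fun h => h.mono fun w hw => by rw [Multiset.prod_singleton, hw]
  have huone : ∀ᶠ w : HeightOneSpectrum (𝓞 F) in cofinite, ‖(({1} : Multiset ℂ)).prod‖ = 1 :=
    Eventually.of_forall fun w => by rw [Multiset.prod_singleton, norm_one]
  -- the automorphic data
  obtain ⟨Q₁, hQ₁⟩ := CuspidalAutomorphicRepData.exists_twist_hecke_hasSatakeParamAt ul Pd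
  obtain ⟨Q₂, hQ₂⟩ := CuspidalAutomorphicRepData.exists_twist_hecke_hasSatakeParamAt (ul * ul) Pd
  obtain ⟨Qa, hQa⟩ := CuspidalAutomorphicRepData.exists_twist_hecke_hasSatakeParamAt (ul * u) P
  obtain ⟨Qb, hQb⟩ := CuspidalAutomorphicRepData.exists_twist_hecke_hasSatakeParamAt (u⁻¹ * ul * ul) Pd
  obtain ⟨τ₀, hτ₀⟩ := exists_cuspidal_glOne_hasSatakeParamAt_one h1
  obtain ⟨τ₃, hτ₃⟩ := exists_cuspidal_glOne_hasSatakeParamAt_valueAtUniformizer h1 (ul * ul * ul)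
  obtain ⟨τ₁, hτ₁⟩ := exists_cuspidal_glOne_hasSatakeParamAt_valueAtUniformizer h1 ul
  obtain ⟨τ₂, hτ₂⟩ := exists_cuspidal_glOne_hasSatakeParamAt_valueAtUniformizer h1 (ul * ul)
  -- the families (unitary parts)
  set αd : SatakeFamily F := fun w => (α w).map (·⁻¹) with hαd
  set A₁ : SatakeFamily F := fun w => (αd w).map (ul.valueAtUniformizer w * ·) with hA₁
  set A₂ : SatakeFamily F := fun w => (αd w).map ((ul * ul).valueAtUniformizer w * ·) with hA₂
  set Aa : SatakeFamily F := fun w => (α w).map ((ul * u).valueAtUniformizer w * ·) with hAa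
  set Ab : SatakeFamily F := fun w => (αd w).map ((u⁻¹ * ul * ul).valueAtUniformizer w * ·) with hAb
  set one : SatakeFamily F := fun _ => {1} with hone
  set u₃ : SatakeFamily F := fun w => {(ul * ul * ul).valueAtUniformizer w} with hu₃
  set uκ : SatakeFamily F := fun w => {(ul * u).valueAtUniformizer w} with huκ
  set u₁ : SatakeFamily F := fun w => {ul.valueAtUniformizer w} with hu₁
  set u₂ : SatakeFamily F := fun w => {(ul * ul).valueAtUniformizer w} with hu₂
  set ue : SatakeFamily F := fun w => {u.valueAtUniformizer w} with hue
  set uf : SatakeFamily F := fun w => {(ul * ul * u).valueAtUniformizer w} with huf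
  set B₆ : SatakeFamily F := fun w => wedgeTwoParams (α w) with hB₆
  have hQ₁' : ∀ᶠ w : HeightOneSpectrum (𝓞 F) in cofinite, Q₁.1.HasSatakeParamAt w (A₁ w) := by
    filter_upwards [hPd, hQ₁] with w h h'; exact h' _ h
  have hQ₂' : ∀ᶠ w : HeightOneSpectrum (𝓞 F) in cofinite, Q₂.1.HasSatakeParamAt w (A₂ w) := by
    filter_upwards [hPd, hQ₂] with w h h'; exact h' _ h
  have hQa' : ∀ᶠ w : HeightOneSpectrum (𝓞 F) in cofinite, Qa.1.HasSatakeParamAt w (Aa w) := by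
    filter_upwards [hP, hQa] with w h h'; exact h' _ h
  have hQb' : ∀ᶠ w : HeightOneSpectrum (𝓞 F) in cofinite, Qb.1.HasSatakeParamAt w (Ab w) := by
    filter_upwards [hPd, hQb] with w h h'; exact h' _ h
  -- the eleven analytic packages
  obtain ⟨S₁, hS₁, pk₁⟩ := analyticPackage_fourFour hJ2 hJ3 P Q₁ α A₁ hP hQ₁' huα (hutw hnul huαd)
  obtain ⟨S₂, hS₂, pk₂⟩ := analyticPackage_fourFour hJ2 hJ3 P Q₂ α A₂ hP hQ₂' huα
    (hutw (hn2 hnul hnul) huαd)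
  obtain ⟨S₃, hS₃, pk₃⟩ := analyticPackage_oneOne τ₀ τ₀ one one hτ₀ hτ₀ huone huone
  obtain ⟨S₄, hS₄, pk₄⟩ := analyticPackage_oneOne τ₃ τ₀ u₃ one hτ₃ hτ₀ (hu1 (hn2 (hn2 hnul hnul) hnul))
    huone
  obtain ⟨S₅, hS₅, pk₅⟩ := analyticPackage_repData hJ2 (n := 6) (by norm_num) P₆ B₆ hP₆ huB (ul * u)
    (hn2 hnul hnu')
  obtain ⟨Sa, hSa, pka⟩ := analyticPackage_fourFour hJ2 hJ3 P Qa α Aa hP hQa' huα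
    (hutw (hn2 hnul hnu') huα)
  obtain ⟨Sb, hSb, pkb⟩ := analyticPackage_fourFour hJ2 hJ3 Pd Qb αd Ab hPd hQb' huαd
    (hutw (hn2 (hn2 hnui hnul) hnul) huαd)
  obtain ⟨Sc, hSc, pkc⟩ := analyticPackage_oneOne τ₁ τ₀ u₁ one hτ₁ hτ₀ (hu1 hnul) huone
  obtain ⟨Sd, hSd, pkd⟩ := analyticPackage_oneOne τ₂ τ₀ u₂ one hτ₂ hτ₀ (hu1 (hn2 hnul hnul)) huone
  obtain ⟨Se, hSe, pke⟩ := analyticPackage_repData hJ2 (n := 6) (by norm_num) P₆ B₆ hP₆ huB u hnu'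
  obtain ⟨Sf, hSf, pkf⟩ := analyticPackage_repData hJ2 (n := 6) (by norm_num) P₆ B₆ hP₆ huB
    (ul * ul * u) (hn2 (hn2 hnul hnul) hnu')
  obtain ⟨E, hE, hgoodE⟩ : ∃ E : Set (HeightOneSpectrum (𝓞 F)), E.Finite ∧ ∀ w ∉ E,
      P.1.HasSatakeParamAt w (α w) ∧ Ω.valueAtUniformizer w = (α w).prod ∧ ∃ β γ : Multiset ℂ,
        β + γ = α w ∧ Multiset.card β = 2 ∧ β.prod = χ.valueAtUniformizer w :=
    ⟨_, Filter.eventually_cofinite.1 hgood, fun w hw => not_not.1 hw⟩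
  set T : Set (HeightOneSpectrum (𝓞 F)) :=
    E ∪ S₁ ∪ S₂ ∪ S₃ ∪ S₄ ∪ S₅ ∪ Sa ∪ Sb ∪ Sc ∪ Sd ∪ Se ∪ Sf with hT_def
  have hT : T.Finite := ((((((((((hE.union hS₁).union hS₂).union hS₃).union hS₄).union hS₅).union
    hSa).union hSb).union hSc).union hSd).union hSe).union hSf
  have subE : E ⊆ T := fun x hx => by simp [hT_def, hx]
  have sub₁ : S₁ ⊆ T := fun x hx => by simp [hT_def, hx]
  have sub₂ : S₂ ⊆ T := fun x hx => by simp [hT_def, hx]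
  have sub₃ : S₃ ⊆ T := fun x hx => by simp [hT_def, hx]
  have sub₄ : S₄ ⊆ T := fun x hx => by simp [hT_def, hx]
  have sub₅ : S₅ ⊆ T := fun x hx => by simp [hT_def, hx]
  have suba : Sa ⊆ T := fun x hx => by simp [hT_def, hx]
  have subb : Sb ⊆ T := fun x hx => by simp [hT_def, hx]
  have subc : Sc ⊆ T := fun x hx => by simp [hT_def, hx]
  have subd : Sd ⊆ T := fun x hx => by simp [hT_def, hx]
  have sube : Se ⊆ T := fun x hx => by simp [hT_def, hx]
  have subf : Sf ⊆ T := fun x hx => by simp [hT_def, hx]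
  -- conclude by the abstract core
  refine false_of_twoTwo_eulerIdentity_of_shift α A₁ A₂ one u₃ B₆ uκ Aa αd Ab u₁ u₂ ue uf hT
    (fun _ => rfl) ?_ ?_ ht ?_
  · -- multipliability of the eleven Euler products
    intro S hS hTS s hs
    exact ⟨(pk₁ hS (sub₁.trans hTS)).1 s hs, (pk₂ hS (sub₂.trans hTS)).1 s hs,
      (pk₃ hS (sub₃.trans hTS)).1 s hs, (pk₄ hS (sub₄.trans hTS)).1 s hs,
      (pk₅ hS (sub₅.trans hTS)).1 s hs, (pka hS (suba.trans hTS)).1 s hs,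
      (pkb hS (subb.trans hTS)).1 s hs, (pkc hS (subc.trans hTS)).1 s hs,
      (pkd hS (subd.trans hTS)).1 s hs, (pke hS (sube.trans hTS)).1 s hs,
      (pkf hS (subf.trans hTS)).1 s hs⟩
  · -- continuity (and non-vanishing) on `Re s > 1`
    intro S hS hTS s hs
    exact ⟨(pk₁ hS (sub₁.trans hTS)).2.1 s hs, (pk₂ hS (sub₂.trans hTS)).2.1 s hs,
      (pk₄ hS (sub₄.trans hTS)).2.1 s hs, (pk₅ hS (sub₅.trans hTS)).2.1 s hs,
      ((pka hS (suba.trans hTS)).2.1 s hs).1, ((pkb hS (subb.trans hTS)).2.1 s hs).1,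
      ((pkc hS (subc.trans hTS)).2.1 s hs).1, ((pkd hS (subd.trans hTS)).2.1 s hs).1,
      ((pke hS (sube.trans hTS)).2.1 s hs).1, ((pkf hS (subf.trans hTS)).2.1 s hs).1⟩
  · -- the Euler-factor identity at a good place: undo the shifts, then the 46-term identity
    intro w hw
    obtain ⟨hPw, hΩw, β, γ, hβγ, hβ2, hx⟩ := hgoodE w (fun h => hw (subE h))
    have h0 : (0 : ℂ) ∉ α w := fun h0 => hasSatakeParamAt_ne_zero_holds hPw 0 h0 rfl
    have hβ0 : (0 : ℂ) ∉ β := fun h => h0 (hβγ ▸ Multiset.mem_add.2 (Or.inl h))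
    have hγ0 : (0 : ℂ) ∉ γ := fun h => h0 (hβγ ▸ Multiset.mem_add.2 (Or.inr h))
    have hγ2 : Multiset.card γ = 2 := by
      have h4' := hPw.card_eq
      rw [← hβγ, Multiset.card_add, hβ2] at h4'
      omega
    have hx0 : χ.valueAtUniformizer w ≠ 0 := np_vAU_ne_zero χ w
    have hl0 : lam.valueAtUniformizer w ≠ 0 := np_vAU_ne_zero lam w
    have hC0 : (w.residueCard : ℂ) ^ (((-t : ℝ)) : ℂ) ≠ 0 := hc0 w
    have hy : γ.prod = lam.valueAtUniformizer w * χ.valueAtUniformizer w := by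
      rw [hlamw, hΩw, ← hβγ, Multiset.prod_add, hx]
      field_simp
    -- the shifted twists are the values of `λ, λ², λ³, λχ⁻¹, χλ², χ⁻¹, λ²χ⁻¹` at `ϖ`
    have e1 : (w.residueCard : ℂ) ^ (((-(2 * t) : ℝ)) : ℂ) * ul.valueAtUniformizer w =
        lam.valueAtUniformizer w := by
      rw [hc2, hulw, huw, hlamw]; field_simp
    have e2 : (w.residueCard : ℂ) ^ (((-(4 * t) : ℝ)) : ℂ) *
        (ul.valueAtUniformizer w * ul.valueAtUniformizer w) = lam.valueAtUniformizer w ^ 2 := by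
      rw [hc4, hulw, huw, hlamw]; field_simp
    have e3 : (w.residueCard : ℂ) ^ (((-(6 * t) : ℝ)) : ℂ) *
        (ul.valueAtUniformizer w * ul.valueAtUniformizer w * ul.valueAtUniformizer w) =
          lam.valueAtUniformizer w ^ 3 := by
      rw [hc6, hulw, huw, hlamw]; field_simp
    have e5 : (w.residueCard : ℂ) ^ (((-(3 * t) : ℝ)) : ℂ) *
        (ul.valueAtUniformizer w * u.valueAtUniformizer w) =
          lam.valueAtUniformizer w * (χ.valueAtUniformizer w)⁻¹ := by
      rw [hc3, hulw, huw, hlamw]; field_simp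
    have eb : (w.residueCard : ℂ) ^ (((-(3 * t) : ℝ)) : ℂ) *
        ((u.valueAtUniformizer w)⁻¹ * ul.valueAtUniformizer w * ul.valueAtUniformizer w) =
          χ.valueAtUniformizer w * lam.valueAtUniformizer w ^ 2 := by
      rw [hc3, hulw, huw, hlamw]; field_simp
    have ee : (w.residueCard : ℂ) ^ (((-t : ℝ)) : ℂ) * u.valueAtUniformizer w =
        (χ.valueAtUniformizer w)⁻¹ := by
      rw [huw]; field_simp
    have ef : (w.residueCard : ℂ) ^ (((-(5 * t) : ℝ)) : ℂ) *
        (ul.valueAtUniformizer w * ul.valueAtUniformizer w * u.valueAtUniformizer w) =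
          lam.valueAtUniformizer w ^ 2 * (χ.valueAtUniformizer w)⁻¹ := by
      rw [hc5, hulw, huw, hlamw]; field_simp
    simp only [hA₁, hA₂, hAa, hAb, hαd, hone, hu₃, huκ, hu₁, hu₂, hue, huf, hB₆, np_vAU_mul, np_vAU_inv,
      np_map_const_mul_map_const_mul, Multiset.map_singleton, ← hβγ]
    rw [e1, e2, e3, e5, eb, ee, ef]
    exact satakePairPolynomial_twoTwo_identity hβ2 hγ2 hβ0 hγ0 hx hy hx0 hl0

end DataOff

end Summit.Langlands.Langlands.Cruxes.ReducibleInducesSquare.Sketch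

end
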